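import Summits.NavierStokesRegularity.FluidComputer.GateBudgetSecondCold
import HarnessLib

/-!
# What no tuning can beat, part 45: THE CLOCK AT THE SECOND DOUSING IS TWO-SIDED — a pulse
# moves the trigger pair's radius `b² + c²` by at most `10⁻⁶ε²`, so a lattice dud's second
# pulse flips its re-lit clock `b(r₁) ∈ [1.394ε, 1.44ε]` to `b(T₂) ∈ [-1.4401ε, -1.3939ε]`,
# and the second cold window is `[T₂, T₂ + 2.7878]` — `98.5%` of the first (`2.8282`)

Cell `pub-fluidc`, blueprint seat bp1 (gen 33, fifth item); same namespace and conventions as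
parts 1–44 (`GateBudget*.lean`); imports part 44 (`GateBudgetSecondCold`: cold for `2θ` after
any dousing, and through it parts 43 `GateBudgetDrainReset`, 42, 41 `GateBudgetSecondIgnition`,
38 `GateBudgetSharpRefire`, 18 `GateBudgetPulseWindow`, 10 `GateBudgetPulse`). Modes `0 = a`
carrier, `1 = b` clock, `2 = c` trigger, `3 = d` transfer, `4 = ã` output; `t₋ = √(2 - 24 log
K/K¹⁰)`, `t₊ = √(2 + 2/K¹⁰) + 242/K⁹`, `λ₀ = K⁻¹⁰ + 4e^{-K¹⁰}/K¹⁰`.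
HONEST FRAMING (verbatim): low prior, high value-of-information experiment on Tao's machine
paradigm; NOT a claim that NS blows up.

THE SYSTEM. The rotor-gate `K`-family `rotorCircuit K M ε ρ` of Theorem 5.3 / (5.6) (in
five-gate form `fiveGateCircuit ε σ μ R K`, `σ = ρ²e^{-M}`, `μ = ε⁻¹M`), from `delayInit`; the
headline coupling `M = K¹⁰` on the tuning window `200ε/K²⁰ ≤ ρ² ≤ 2ε/K¹⁰`, `ε² ≤ 1/(6K²⁰)`,
`K ≥ 16`; a LATTICE DUD is a member with `ε = k·K¹⁰ρ²` (`k ∈ ℕ`): its clock is doused at `T ∈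
[t₋, t₊]` with `b(T) = -√2ε ± 10⁻⁶ε`, vanishes at `tz ∈ [T + 1.414213, T + 1.4242]`, the
trigger re-lights at `r₁ ∈ (T + 2.8282, T + 2.8542)` with `b ≥ 0.993ε(r - tz)` on `[tz, r₁]`
(parts 38, 43), and the second pulse `[r₁, T₂]` lasts `≤ 242/K⁹` and is doused with `b(T₂) ≤
-ε/4`, `c(T₂) ≤ λ₀ρ²` (part 41).

THE STATEMENTS. §134 `radius_upper` — THE UPPER RADIUS LAW (every five-gate circuit, `ε, σ ≥
0`): for `0 ≤ s ≤ t`, `b(t)² + c(t)² ≤ b(s)² + c(s)² + (ε + σ)²(t² - s²)`; with part 10's lower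
law `≥ b(s)² + c(s)² - ε(ε + σ)(t² - s²)` the trigger pair's radius moves by `O(ε²t·Δt)` only.
§135 `knob_pulse_radius_kept` — A PULSE KEEPS THE RADIUS: at `M = K¹⁰` (`K ≥ 16`, `0 < ε`,
`ρ² ≤ ε`), for `0 ≤ s ≤ T ≤ 5` with `T - s ≤ 242/K⁹`: `|b(T)² + c(T)² - (b(s)² + c(s)²)| ≤
ε²/10⁶`. §136 `knob_dud_second_dousing` — THE MASTER TUPLE OF THE FIRST TWO PULSES OF A
LATTICE DUD: times `T, tz, r₁, T₂` carrying part 41's twelve second-ignition facts VERBATIM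
(so that part 42's misfire proof re-runs on this tuple unchanged), part 43's first-pulse and gap
facts (`b(T)` two-sided, `b(tz) = 0`, the re-arming slope on `[tz, r₁]`, `r₁ - T ∈ (2.8282,
2.8542)`, `d(r₁)² ≤ 1/(7K²) + 6/K⁹`), AND the new ones: the re-lit clock `1.394ε ≤ b(r₁) ≤
1.44ε`, the kept radius `|b² + c² - (b(r₁)² + c(r₁)²)| ≤ ε²/10⁶` on `[r₁, T₂]`, the doused
clock `-1.4401ε ≤ b(T₂) ≤ -1.3939ε`, and the second cold window: `c < ρ²/K⁹` on `[T₂, T₂ +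
2.7878]`.

HOW. §134: `∂ₜ(b² + c²) = 2a²(εb + σc)` (part 1's `bc_energy`; the amplifier terms `∓μbc²`
cancel) `≤ 2ε|b| + 2σc ≤ 2(ε + σ)²t` by `a² ≤ 1`, `c ≥ 0` and part 1's budgets `|b|, c ≤ (ε +
σ)t`; integrate (`antitoneOn_sub_of_deriv_le`), exactly as part 10 proved the lower law. §135:
both laws with `σ = ρ²e^{-K¹⁰} ≤ ε`, `t² - s² = (t - s)(t + s) ≤ (242/K⁹)·10` and `K⁹ ≥
68719476736`: `4ε²·2420/K⁹ ≤ ε²/10⁶`. §136: part 43's `knob_dud_relights_empty` gives `T, tz,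
r₁`; `b(r₁) ≥ 0.993ε(r₁ - tz) ≥ 0.993·1.404ε ≥ 1.394ε` and, by part 7's `clock_recovery` from
`tz` (`b' ≤ ε`, `b(tz) = 0`), `b(r₁) ≤ ε(r₁ - tz) ≤ 1.439987ε`; then part 41's §126 argument
VERBATIM (part 18's `knob_pulse_window` at `s₀ = r₁`, `H = 1/16`, `β = ε/4`, `ϱ = 7ε/10`, `γ =
13ε/20`, `λ₁ = λ = K⁻¹⁰`, §125's budget `≤ 242/K⁹`) gives `T₂`; §135 on `[r₁, T₂]` (`T₂ ≤ 5`);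
at `T₂`: `c(r₁) = ρ²/K⁹ ≤ ε/1000`, `0 ≤ c(T₂) ≤ 2ρ²/K¹⁰ ≤ ε/1000`, so `b(T₂)² ∈ [b(r₁)² -
2·10⁻⁶ε², b(r₁)² + 2·10⁻⁶ε²] ⊆ [1.943234ε², 2.073602ε²]`, and `b(T₂) ≤ -ε/4 < 0` picks the
negative root: `1.3939² = 1.94295721`, `1.4401² = 2.07388801`; the cold window is part 44's
§131 at `θ = 1.3939`.

READING. The quantity that sets every cold window — the doused clock `-b/ε` (part 44 §131:
window = twice it) — is now under two-sided control after the SECOND pulse: `1.3939 ≤ -b(T₂)/ε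
≤ 1.4401`, against `1.414213 ≤ -b(T)/ε ≤ 1.414214` after the first. So the second cold window
is `≥ 2.7878`, i.e. `≥ 98.5%` of the first (`2.8282`), the pulse train's period `≈ 2√2 + 2√2`
is stable to `1.5%` over two pulses, and the `3%` spread is not dynamics but bookkeeping: it is
the spread of part 43's brackets `r₁ - tz ∈ [1.404, 1.44]` and of the re-arming slope `[0.993ε,
ε]`, both inherited from the FIRST gap. With part 42's misfire re-run on this tuple (its proof
consumes exactly the twelve facts re-exported here) the output pair at `T₂` is `≤ 1/60` (part
43's `d(r₁)²` bound is in the tuple), part 33's `dud_clock_rearms`/`dud_refires` re-enter at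
`T₂` with `β = 1.4401ε`, and the THIRD ignition follows with `b(r₂) ≳ (2·0.97·1.3939 -
1.4401)ε ≈ 1.26ε` — the induction over pulses, with a window shrinking by a bookkeeping factor
per pulse, needs no new dynamics.

HONEST LIMITS. (i) The misfire numbers at `T₂` (`d² + ã² ≤ 1/40`, phase `kπ ± 0.07`) are NOT
in this tuple: part 42 proved them on part 41's witnesses, and re-running its 230-line proof
here is left to the successor (it applies verbatim); hence no re-arming after `T₂` and no third
ignition in this file; (ii) the true clock is `b(T₂) = -√2ε + O(ε/K⁹)`; the `3%` bracket is
the cost of not re-basing parts 29–31 (the Gaussian budget) at the second pulse, and it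
compounds per pulse, so an UNBOUNDED pulse count still needs the sharp version; (iii) lattice
duds only (`ε = k·K¹⁰ρ²`); (iv) `M = K¹⁰`, `K ≥ 16`, `200ε/K²⁰ ≤ ρ² ≤ 2ε/K¹⁰`, `ε² ≤
1/(6K²⁰)` (§134: any five-gate circuit; §135: `K ≥ 16`, `0 < ε`, `0 < ρ`, `ρ² ≤ ε`); (v)
nothing about Navier–Stokes.
[cite: Tao2016AveragedNS, §5.5 Theorem 5.3, (5.5), (5.6), (b-eq), (c-eq), (energy-con)]
-/

noncomputable section

namespace Summit.NavierStokesRegularity.FluidComputer.GateBudget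

open Real Set Filter Topology
open Literature.Analysis.FluidPDE.Tao2016AveragedNS
open Literature.Analysis.FluidPDE.Tao2016AveragedNS.Thm53 (antitoneOn_sub_of_deriv_le)

section RadiusLaw

variable {ε σ μ R K : ℝ} {X : ℝ → Fin 5 → ℝ}

/-! ## §134 The upper radius law: the seed and the clock pump add at most `2(ε + σ)²t` -/

/-- Pointwise: with `a² ≤ 1`, `0 ≤ c ≤ C`, `|b| ≤ B` and `ε, σ ≥ 0`,
`∂ₜ(b² + c²) = 2εa²b + 2σa²c ≤ 2εB + 2σC`. [cite: Tao2016AveragedNS, §5.5 proof (ob-2)] -/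
theorem radius_deriv_upper {a b c B C : ℝ} (ha : a ^ 2 ≤ 1) (hc : 0 ≤ c) (hb : |b| ≤ B)
    (hcC : c ≤ C) (hε : 0 ≤ ε) (hσ : 0 ≤ σ) :
    2 * ε * a ^ 2 * b + 2 * σ * a ^ 2 * c ≤ 2 * ε * B + 2 * σ * C := by
  have ha0 : 0 ≤ a ^ 2 := sq_nonneg a
  have hB : 0 ≤ B := (abs_nonneg b).trans hb
  have h1 : b ≤ B := (abs_le.1 hb).2
  have h2 : a ^ 2 * b ≤ B := by
    nlinarith [mul_le_mul_of_nonneg_left h1 ha0, mul_le_of_le_one_left hB ha]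
  have h3 : a ^ 2 * c ≤ C := by
    nlinarith [mul_le_mul_of_nonneg_left hcC ha0, mul_le_of_le_one_left (hc.trans hcC) ha]
  nlinarith [mul_le_mul_of_nonneg_left h2 hε, mul_le_mul_of_nonneg_left h3 hσ]

/-- **THE UPPER RADIUS LAW.** For `0 ≤ s ≤ t` (`ε, σ ≥ 0`; every `μ, R, K`):
`b(t)² + c(t)² ≤ b(s)² + c(s)² + (ε + σ)²(t² - s²)` — the amplifier rotates the trigger pair
without changing its radius (`∂ₜ(b² + c²) = 2a²(εb + σc)`, part 1's `bc_energy`), and the clock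
pump and the seed add at most `2ε|b| + 2σc ≤ 2(ε + σ)²t` per unit time (part 1's budgets
`|b|, c ≤ (ε + σ)t`). The converse of part 10's `radius_lower`.
[cite: Tao2016AveragedNS, §5.5 proof (ob-2), (b-eq), (c-eq)] -/
theorem radius_upper (hX : ∀ t, HasDerivAt X (fiveGateCircuit ε σ μ R K (X t)) t)
    (h0 : X 0 = delayInit) (hε : 0 ≤ ε) (hσ : 0 ≤ σ) {s t : ℝ} (hs : 0 ≤ s) (hst : s ≤ t) :
    X t 1 ^ 2 + X t 2 ^ 2 ≤ X s 1 ^ 2 + X s 2 ^ 2 + (ε + σ) ^ 2 * (t ^ 2 - s ^ 2) := by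
  have hanti := antitoneOn_sub_of_deriv_le (f := fun r => X r 1 ^ 2 + X r 2 ^ 2)
    (f' := fun r => 2 * ε * X r 0 ^ 2 * X r 1 + 2 * σ * X r 0 ^ 2 * X r 2)
    (φ := fun r => (2 * (ε + σ) ^ 2) * r) (Φ := fun r => (2 * (ε + σ) ^ 2) * r ^ 2 / 2)
    (convex_Ici 0) (fun r _ => bc_energy (hX r)) (fun r _ => hasDerivAt_sq_half _ r)
    (fun r hr => by
      have h := radius_deriv_upper (ε := ε) (σ := σ) (traj_sq_le_one hX h0 r 0)
        (c_nonneg hX h0 hσ hr) (abs_b_le hX h0 hε hσ hr) (c_le hX h0 hε hσ hr) hε hσ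
      have h1 : 2 * ε * ((ε + σ) * r) + 2 * σ * ((ε + σ) * r) = (2 * (ε + σ) ^ 2) * r := by
        ring
      show 2 * ε * X r 0 ^ 2 * X r 1 + 2 * σ * X r 0 ^ 2 * X r 2 ≤ (2 * (ε + σ) ^ 2) * r
      linarith)
  have h := hanti (mem_Ici.2 hs) (mem_Ici.2 (hs.trans hst)) hst
  dsimp only at h
  linarith

end RadiusLaw

variable {K ε ρ : ℝ} {X : ℝ → Fin 5 → ℝ} {C : ℝ → ℝ}

/-! ## §135 A pulse keeps the trigger pair's radius to `10⁻⁶ε²` (`M = K¹⁰`) -/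

/-- **A PULSE KEEPS THE RADIUS.** At `M = K¹⁰` (`K ≥ 16`, `0 < ε`, `0 < ρ`, `ρ² ≤ ε`), along
the exact trajectory of `rotorCircuit K K¹⁰ ε ρ` from (5.6): for `0 ≤ s ≤ T ≤ 5` with `T - s ≤
242/K⁹` (the pulse length of parts 18/41), `|b(T)² + c(T)² - (b(s)² + c(s)²)| ≤ ε²/10⁶` —
part 10's lower and §134's upper radius laws with `σ = ρ²e^{-K¹⁰} ≤ ε`, `t² - s² ≤ 2420/K⁹`.
[cite: Tao2016AveragedNS, §5.5 Theorem 5.3, (b-eq), (c-eq), proof (ob-2)] -/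
theorem knob_pulse_radius_kept
    (hX : ∀ t, HasDerivAt X (RotorKnob.rotorCircuit K (K ^ 10) ε ρ (X t)) t)
    (h0 : X 0 = delayInit) (hK : 16 ≤ K) (hε : 0 < ε) (hρε : ρ ^ 2 ≤ ε) {s T : ℝ}
    (hs : 0 ≤ s) (hsT : s ≤ T) (hTs : T - s ≤ 242 / K ^ 9) (hT5 : T ≤ 5) :
    |X T 1 ^ 2 + X T 2 ^ 2 - (X s 1 ^ 2 + X s 2 ^ 2)| ≤ ε ^ 2 / 10 ^ 6 := by
  have hK0 : 0 < K := by linarith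
  have hK10 : 0 < K ^ 10 := by positivity
  have hε2 : 0 < ε ^ 2 := by positivity
  have h9 : (68719476736 : ℝ) ≤ K ^ 9 := by
    have := headline_pow_floor hK 9; norm_num at this; exact this
  have hXf := hX
  rw [RotorKnob.rotorCircuit_eq_fiveGate] at hXf
  obtain ⟨hσ0, hσε⟩ := knob_seed_le hε hρε hK10.le
  have hlow := radius_lower hXf h0 hε.le hσ0 hs hsT
  have hup := radius_upper hXf h0 hε.le hσ0 hs hsT
  have hq : (242 : ℝ) / K ^ 9 ≤ 242 / 68719476736 :=
    div_le_div_of_nonneg_left (by norm_num) (by norm_num) h9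
  have hd : T ^ 2 - s ^ 2 ≤ 242 / 68719476736 * 10 := by
    rw [show T ^ 2 - s ^ 2 = (T - s) * (T + s) by ring]
    exact mul_le_mul (hTs.trans hq) (by linarith) (by linarith) (by norm_num)
  have hnn : 0 ≤ T ^ 2 - s ^ 2 := by
    rw [show T ^ 2 - s ^ 2 = (T - s) * (T + s) by ring]
    exact mul_nonneg (by linarith) (by linarith)
  have h0 : ε * (ε + ρ ^ 2 * exp (-K ^ 10)) ≤ 2 * ε ^ 2 := by
    have := mul_le_mul_of_nonneg_left hσε hε.le
    linarith only [this]
  have h1 : ε * (ε + ρ ^ 2 * exp (-K ^ 10)) * (T ^ 2 - s ^ 2) ≤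
      2 * ε ^ 2 * (242 / 68719476736 * 10) :=
    mul_le_mul h0 hd hnn (by positivity)
  have h2 : (ε + ρ ^ 2 * exp (-K ^ 10)) ^ 2 ≤ (2 * ε) ^ 2 :=
    pow_le_pow_left₀ (by linarith) (by linarith) 2
  have h3 : (ε + ρ ^ 2 * exp (-K ^ 10)) ^ 2 * (T ^ 2 - s ^ 2) ≤
      (2 * ε) ^ 2 * (242 / 68719476736 * 10) :=
    mul_le_mul h2 hd hnn (by positivity)
  rw [abs_le]
  constructor
  · linarith only [hlow, h1, hε2]
  · linarith only [hup, h3, hε2]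

/-! ## §136 The master tuple of a lattice dud's first two pulses; the two-sided second clock -/

/-- **THE CLOCK AT THE SECOND DOUSING IS TWO-SIDED.** `K ≥ 16`, `0 < ε`, `ε² ≤ 1/(6K²⁰)`, an
exact trajectory of `rotorCircuit K K¹⁰ ε ρ` from (5.6) with `200ε/K²⁰ ≤ ρ² ≤ 2ε/K¹⁰` ON THE
LATTICE `ε = kK¹⁰ρ²`: there are times `T, tz, r₁, T₂` with (a) part 41's twelve
second-ignition facts verbatim (`r₁ ∈ (t₋ + 2.8282, t₊ + 2.8542)`, `r₁ < T₂`, `T₂ - r₁ ≤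
242/K⁹`, `c > 0` and `b² + c² ≥ (7ε/10)²` on `[r₁, T₂]`, `b(r₁) ≥ 1.39ε`, `c(r₁) = ρ²/K⁹`,
`b(T₂) ≤ -ε/4`, `c(T₂) ≤ λ₀ρ²`, `a(r₁)² ≥ 0.993`, `ã(T₂) ≤ ã(r₁) + K(T₂ - r₁)`); (b) part 43's
first dousing `T ∈ [t₋, t₊]` with `-1.414214ε ≤ b(T) ≤ -1.414213ε`, the clock's zero `tz ∈ [T
+ 1.414213, T + 1.4242]`, the re-arming `c ≤ ρ²/K⁹`, `b ≥ 0.993ε(r - tz)`, `a² ≥ 0.993` on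
`[tz, r₁]`, `r₁ ∈ (T + 2.8282, T + 2.8542)`, `d(r₁)² ≤ 1/(7K²) + 6/K⁹`; (c) NEW: `1.394ε ≤
b(r₁) ≤ 1.44ε`, `|b² + c² - (b(r₁)² + c(r₁)²)| ≤ ε²/10⁶` on `[r₁, T₂]`, `-1.4401ε ≤ b(T₂) ≤
-1.3939ε`, and `c < ρ²/K⁹` on `[T₂, T₂ + 2.7878]` (part 44's §131 at `θ = 1.3939`).
[cite: Tao2016AveragedNS, §5.5 Theorem 5.3, (5.5), (5.6), (b-eq), (c-eq), (energy-con)] -/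
theorem knob_dud_second_dousing
    (hX : ∀ t, HasDerivAt X (RotorKnob.rotorCircuit K (K ^ 10) ε ρ (X t)) t)
    (h0 : X 0 = delayInit) (hC : ∀ t, HasDerivAt C (X t 2) t) (hK : 16 ≤ K) (hε : 0 < ε)
    (hεK : ε ^ 2 ≤ 1 / (6 * K ^ 20)) (hρ : 0 < ρ) (hlo : 200 * ε / K ^ 20 ≤ ρ ^ 2)
    (hhi : K ^ 10 * ρ ^ 2 ≤ 2 * ε) (k : ℕ) (hk : ε = k * K ^ 10 * ρ ^ 2) :
    ∃ T tz r₁ T₂ : ℝ, (√(2 - 24 * Real.log K / K ^ 10) + 28282 / 10000 < r₁ ∧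
      r₁ < √(2 + 2 / K ^ 10) + 242 / K ^ 9 + 28542 / 10000 ∧ r₁ < T₂ ∧
      T₂ - r₁ ≤ 242 / K ^ 9 ∧
      (∀ t ∈ Icc r₁ T₂, 0 < X t 2) ∧
      (∀ t ∈ Icc r₁ T₂, (7 / 10 * ε) ^ 2 ≤ X t 1 ^ 2 + X t 2 ^ 2) ∧
      139 / 100 * ε ≤ X r₁ 1 ∧ X r₁ 2 = ρ ^ 2 / K ^ 9 ∧ X T₂ 1 ≤ -(ε / 4) ∧
      X T₂ 2 ≤ (1 / K ^ 10 + 4 * exp (-K ^ 10) / K ^ 10) * ρ ^ 2 ∧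
      993 / 1000 ≤ X r₁ 0 ^ 2 ∧ X T₂ 4 ≤ X r₁ 4 + K * (T₂ - r₁)) ∧
      (√(2 - 24 * Real.log K / K ^ 10) ≤ T ∧ T ≤ √(2 + 2 / K ^ 10) + 242 / K ^ 9 ∧
      -(1414214 / 1000000 * ε) ≤ X T 1 ∧ X T 1 ≤ -(1414213 / 1000000 * ε) ∧
      T + 1414213 / 1000000 ≤ tz ∧ tz ≤ T + 14242 / 10000 ∧ X tz 1 = 0 ∧
      (∀ r ∈ Icc tz r₁, X r 2 ≤ ρ ^ 2 / K ^ 9 ∧ 993 / 1000 * ε * (r - tz) ≤ X r 1 ∧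
        993 / 1000 ≤ X r 0 ^ 2) ∧
      T + 28282 / 10000 < r₁ ∧ r₁ < T + 28542 / 10000 ∧
      X r₁ 3 ^ 2 ≤ 1 / (7 * K ^ 2) + 6 / K ^ 9) ∧
      1394 / 1000 * ε ≤ X r₁ 1 ∧ X r₁ 1 ≤ 144 / 100 * ε ∧
      (∀ t ∈ Icc r₁ T₂, |X t 1 ^ 2 + X t 2 ^ 2 - (X r₁ 1 ^ 2 + X r₁ 2 ^ 2)| ≤ ε ^ 2 / 10 ^ 6) ∧
      -(14401 / 10000 * ε) ≤ X T₂ 1 ∧ X T₂ 1 ≤ -(13939 / 10000 * ε) ∧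
      (∀ t ∈ Icc T₂ (T₂ + 27878 / 10000), X t 2 < ρ ^ 2 / K ^ 9) := by
  have hK0 : 0 < K := by linarith
  have hK9 : 0 < K ^ 9 := by positivity
  have hK10 : 0 < K ^ 10 := by positivity
  have hρ2 : 0 < ρ ^ 2 := by positivity
  have hε2 : 0 < ε ^ 2 := by positivity
  have h9 : (68719476736 : ℝ) ≤ K ^ 9 := by
    have := headline_pow_floor hK 9; norm_num at this; exact this
  have h10 : (1099511627776 : ℝ) ≤ K ^ 10 := by
    have := headline_pow_floor hK 10; norm_num at this; exact this
  obtain ⟨hq1, -, -, -, -, -, hρε, -⟩ := refire_window_facts hK hε hεK hhi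
  obtain ⟨-, -, hlam2, -⟩ := cold_facts hK hε
  -- part 43: the first dousing `T`, the clock's zero `tz`, the re-light `r₁`, `d(r₁)²`
  obtain ⟨T, tz, r₁, hT1, hT2, hbTl, hbTu, htz1, htz2, hbtz, -, -, hr1, hr2, hcr₁, hpost,
      hdr₁⟩ := knob_dud_relights_empty hX h0 hC hK hε hεK hρ hlo hhi k hk
  have hT0 : 0 ≤ T := le_trans (Real.sqrt_nonneg _) hT1
  have hr₁0 : 0 ≤ r₁ := by linarith only [hT0, hr1]
  have htzr : tz ≤ r₁ := by linarith only [htz2, hr1]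
  obtain ⟨-, hb1, ha1⟩ := hpost r₁ ⟨htzr, le_rfl⟩
  -- the re-lit clock, two-sided: `0.993ε·1.404 ≤ b(r₁) ≤ ε·1.439987` (`b' ≤ ε` from `tz`)
  have hb1394 : 1394 / 1000 * ε ≤ X r₁ 1 := by
    have h1 : (1404 : ℝ) / 1000 ≤ r₁ - tz := by linarith only [htz2, hr1]
    have h2 := mul_le_mul_of_nonneg_left h1 (by positivity : (0:ℝ) ≤ 993 / 1000 * ε)
    linarith only [h2, hb1, hε]
  have hb139 : 139 / 100 * ε ≤ X r₁ 1 := by linarith only [hb1394, hε]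
  have hXf := hX
  rw [RotorKnob.rotorCircuit_eq_fiveGate] at hXf
  have hb144 : X r₁ 1 ≤ 144 / 100 * ε := by
    have h := clock_recovery hXf h0 hε.le (by positivity) htzr
    rw [hbtz] at h
    have h1 : r₁ - tz ≤ 144 / 100 := by linarith only [htz1, hr2]
    have h2 := mul_le_mul_of_nonneg_left h1 hε.le
    linarith only [h, h2]
  -- part 41's §126 verbatim: the entry time is `≤ 4.4`; part 18 at `s₀ = r₁`
  have hsq : √(2 + 2 / K ^ 10) ≤ 3 / 2 := by
    have h2 : 2 / K ^ 10 ≤ 2 / 1099511627776 :=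
      div_le_div_of_nonneg_left (by norm_num) (by norm_num) h10
    exact (Real.sqrt_le_left (by norm_num)).2 (by linarith only [h2])
  have h242 : (242 : ℝ) / K ^ 9 ≤ 242 / 68719476736 :=
    div_le_div_of_nonneg_left (by norm_num) (by norm_num) h9
  have hr44 : r₁ ≤ 44 / 10 := by linarith only [hr2, hT2, hsq, h242]
  have hKε : 1099511627776 * ε ^ 2 ≤ K ^ 10 * ε ^ 2 := mul_le_mul_of_nonneg_right h10 hε2.le
  have hγε : ε ^ 2 < K ^ 10 * (13 / 20 * ε) ^ 2 := by
    rw [show K ^ 10 * (13 / 20 * ε) ^ 2 = 169 / 400 * (K ^ 10 * ε ^ 2) by ring]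
    linarith only [hKε, hε2]
  have hγϱ : (13 / 20 * ε) ^ 2 + (ε / 4) ^ 2 ≤ (7 / 10 * ε) ^ 2 := by
    rw [show (13 / 20 * ε) ^ 2 + (ε / 4) ^ 2 = 97 / 200 * ε ^ 2 by ring,
      show (7 / 10 * ε) ^ 2 = 49 / 100 * ε ^ 2 by ring]
    linarith only [hε2]
  have harm : (7 / 10 * ε) ^ 2 + 2 * ε ^ 2 * ((r₁ + 1 / 16) ^ 2 - r₁ ^ 2) ≤
      X r₁ 1 ^ 2 + X r₁ 2 ^ 2 := by
    have hb2 : (139 / 100 * ε) * (139 / 100 * ε) ≤ X r₁ 1 * X r₁ 1 :=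
      mul_self_le_mul_self (by positivity) hb139
    have hs : ε ^ 2 * r₁ ≤ ε ^ 2 * (44 / 10) := mul_le_mul_of_nonneg_left hr44 hε2.le
    linarith only [sq_nonneg (X r₁ 2), hb2, hs, hε2]
  have hu₁ : 1 / K ^ 10 * ρ ^ 2 ≤ X r₁ 2 := by
    rw [hcr₁, show 1 / K ^ 10 * ρ ^ 2 = ρ ^ 2 / K ^ 10 by ring]
    exact div_le_div_of_nonneg_left hρ2.le hK9
      (pow_le_pow_right₀ (by linarith : (1:ℝ) ≤ K) (by norm_num : 9 ≤ 10))
  have hbud := second_budget hK hε hρ hlo hr₁0 hr44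
  have hH : (242 : ℝ) / K ^ 9 < 1 / 16 := by linarith only [h242]
  obtain ⟨t₁, t₂, T₂, h01, h12, h2T, hTΔ, hTH, -, -, -, -, hdead, hcT, harmw, hcpos⟩ :=
    knob_pulse_window hX h0 hε hρ hρε hK10 hr₁0 (by norm_num : (0:ℝ) < 1 / 16)
      (by positivity : (0:ℝ) < ε / 4) (by linarith only [hb139, hε])
      (by positivity : (0:ℝ) ≤ 13 / 20 * ε)
      hγϱ hγε harm hu₁ (by positivity : (0:ℝ) < 1 / K ^ 10) le_rfl (lt_of_le_of_lt hbud hH)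
  have hsT : r₁ < T₂ := by linarith only [h01, h12, h2T]
  have hτ : T₂ - r₁ ≤ 242 / K ^ 9 := hTΔ.trans hbud
  have hcT' : X T₂ 2 ≤ (1 / K ^ 10 + 4 * exp (-K ^ 10) / K ^ 10) * ρ ^ 2 := by
    rw [show ε * exp (-K ^ 10) / (K ^ 10 * (ε / 4)) = 4 * exp (-K ^ 10) / K ^ 10 by
      rw [div_eq_div_iff (by positivity) hK10.ne']; ring] at hcT
    exact hcT
  have hbT4 : X T₂ 1 ≤ -(ε / 4) := hdead T₂ ⟨h2T, hTH.le⟩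
  have hT₂0 : 0 ≤ T₂ := by linarith only [hr₁0, hsT]
  have hT₂5 : T₂ ≤ 5 := by linarith only [hr44, hτ, h242]
  have hc : ∀ t ∈ Icc r₁ T₂, 0 < X t 2 :=
    fun t ht => hcpos t ⟨ht.1, by linarith only [ht.2, hTH]⟩
  have hcT2 : X T₂ 2 ≤ 2 * ρ ^ 2 / K ^ 10 := by
    rw [show 2 * ρ ^ 2 / K ^ 10 = 2 * (1 / K ^ 10) * ρ ^ 2 by ring]
    exact hcT'.trans (mul_le_mul_of_nonneg_right hlam2 hρ2.le)
  -- §135 on the pulse: the radius is kept to `10⁻⁶ε²`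
  have hkept : ∀ t ∈ Icc r₁ T₂,
      |X t 1 ^ 2 + X t 2 ^ 2 - (X r₁ 1 ^ 2 + X r₁ 2 ^ 2)| ≤ ε ^ 2 / 10 ^ 6 :=
    fun t ht => knob_pulse_radius_kept hX h0 hK hε hρε hr₁0 ht.1
      (by linarith only [ht.2, hτ]) (by linarith only [ht.2, hT₂5])
  -- the trigger at both ends is `≤ ε/1000`
  have hcs : ρ ^ 2 / K ^ 9 ≤ ε / 1000 := by
    have h1 : ρ ^ 2 / K ^ 9 ≤ ρ ^ 2 / 68719476736 :=
      div_le_div_of_nonneg_left hρ2.le (by norm_num) h9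
    linarith only [h1, hρε, hρ2]
  have hcr2 : X r₁ 2 ^ 2 ≤ (ε / 1000) ^ 2 := by
    rw [hcr₁]; exact pow_le_pow_left₀ (by positivity) hcs 2
  have hc1 : X T₂ 2 ≤ ε / 1000 := by
    have h1 : 2 * (1 / K ^ 10) * ρ ^ 2 ≤ 2 * (1 / 1099511627776) * ε :=
      mul_le_mul (mul_le_mul_of_nonneg_left hq1 (by norm_num)) hρε hρ2.le (by norm_num)
    linarith only [hcT2, h1, hε, show 2 * ρ ^ 2 / K ^ 10 = 2 * (1 / K ^ 10) * ρ ^ 2 by ring]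
  have hc2 : X T₂ 2 ^ 2 ≤ (ε / 1000) ^ 2 :=
    pow_le_pow_left₀ (hc T₂ ⟨hsT.le, le_rfl⟩).le hc1 2
  have hR := abs_le.1 (hkept T₂ ⟨hsT.le, le_rfl⟩)
  -- the doused clock: `b² ∈ [1.943234ε², 2.073602ε²]`, `b ≤ -ε/4 < 0`
  have hbT₂u : X T₂ 1 ≤ -(13939 / 10000 * ε) := by
    by_contra hb
    rw [not_le] at hb
    have h3 := mul_pos (by linarith only [hb] : 0 < 13939 / 10000 * ε + X T₂ 1)
      (by linarith only [hbT4, hε] : 0 < 13939 / 10000 * ε - X T₂ 1)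
    have hb2 : (1394 / 1000 * ε) * (1394 / 1000 * ε) ≤ X r₁ 1 * X r₁ 1 :=
      mul_self_le_mul_self (by positivity) hb1394
    linarith only [hR.1, hb2, hc2, h3, sq_nonneg (X r₁ 2), hε2]
  have hbT₂l : -(14401 / 10000 * ε) ≤ X T₂ 1 := by
    by_contra hb
    rw [not_le] at hb
    have h3 := mul_pos (by linarith only [hb, hε] : 0 < -X T₂ 1 - 14401 / 10000 * ε)
      (by linarith only [hb, hε] : 0 < -X T₂ 1 + 14401 / 10000 * ε)
    have hb2 : X r₁ 1 * X r₁ 1 ≤ (144 / 100 * ε) * (144 / 100 * ε) :=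
      mul_self_le_mul_self (by linarith only [hb1394, hε]) hb144
    linarith only [hR.2, hb2, hcr2, h3, sq_nonneg (X T₂ 2), hε2]
  -- the second cold window: part 44's §131 at `θ = 1.3939`
  have hcold : ∀ t ∈ Icc T₂ (T₂ + 27878 / 10000), X t 2 < ρ ^ 2 / K ^ 9 := by
    have h := knob_cold_of_doused_clock hX h0 hK hε hρ hT₂0 (θ := 13939 / 10000)
      (by norm_num) hbT₂u hcT2
    intro t ht
    exact h t ⟨ht.1, by linarith only [ht.2]⟩
  exact ⟨T, tz, r₁, T₂, ⟨by linarith only [hT1, hr1], by linarith only [hT2, hr2], hsT, hτ,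
    hc, fun t ht => harmw t ⟨ht.1, by linarith only [ht.2, hTH]⟩, hb139, hcr₁, hbT4, hcT', ha1,
    knob_output_growth hX h0 hK0.le hsT.le⟩, ⟨hT1, hT2, hbTl, hbTu, htz1, htz2, hbtz, hpost,
    hr1, hr2, hdr₁⟩, hb1394, hb144, hkept, hbT₂l, hbT₂u, hcold⟩

end Summit.NavierStokesRegularity.FluidComputer.GateBudget
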